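import Mathlib.Topology.NoetherianSpace
import Mathlib.Topology.Sober
import Mathlib.Topology.LocallyClosed
import Mathlib.Order.Minimal
import HarnessLib

/-!
# Upper semi-continuous functions into a partial order on Noetherian sober spaces
# (Cossart–Jannsen–Saito 2020, Lemma 2.34)

Topic: `Literature/Topology/NoetherianSpaces`. The topological lemma behind the Hilbert–Samuel
stratification of Cossart–Jannsen–Saito's *Desingularization: Invariants and Strategy*
(LNM 2270), Ch. 2 (Lemma 2.34, used for Lemma 2.36: the strata `X(ν)` are locally closed,
`X(ν)` is closed for maximal `ν`, the Hilbert–Samuel locus `X_max` is closed, `Σ_X` is finite).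
Setting (loc. cit.): `X` a topological space "which is Zariski, i.e., in which every closed
irreducible subset admits a generic point" (Mathlib: `QuasiSober`) and (locally) Noetherian;
`H : X → G` a map to an ordered set (the source has an ordered abelian group; only the order
is used); `H` is *upper semi-continuous* if `X_{≥ν} = {x | H(x) ≥ ν}` is closed for every
`ν ∈ G`. Conditions: (1) `x ∈ cl{y} ⟹ H(x) ≥ H(y)`; (2) for every `y` there is a dense open
`U ⊆ cl{y}` with `H = H(y)` on `U` (equivalently: an open `U ∋ y` of `X` with `H = H(y)` on
`U ∩ cl{y}`, the form used below).

PROVED here (all hypotheses explicit; no definitions):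

* `le_of_specializes_of_isClosed_setOf_le` — u.s.c. ⟹ (1).
* `isClosed_setOf_le_of_specializes` — **(a), "⇐"**: on a Noetherian quasi-sober space,
  (1) and (2) imply upper semi-continuity (Noetherian induction, as printed).
* `finite_range_of_eqOn_nhds_generic` — **(c)**: on a Noetherian quasi-sober space, (2) implies
  that `H` takes only finitely many values (Noetherian induction, as printed).
* `exists_open_eqOn_closure_of_finite` — **(a), "⇒ (2)"** for u.s.c. `H` WITH FINITELY MANY
  VALUES.
* **(b)** for u.s.c. `H` with finitely many values: `isLocallyClosed_fiber` (`X_ν` is locally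
  closed), `closure_fiber_subset` (`cl X_ν ⊆ X_{≥ν}`), `isClosed_fiber_of_maximal` (`X_ν` is
  closed for `ν` maximal among the values), `isClosed_setOf_maximal` (`X_max` is closed).
* `NoetherianSpace.closeds_irreducible_induction` — the Noetherian induction scheme used:
  a property of closed subsets stable under finite unions holds for all closed subsets as soon
  as it holds for each irreducible closed `Z` whenever it holds for the proper closed subsets
  of `Z`.

## Scope caveat (faithfulness)

Part (a) is printed as an equivalence "u.s.c. ⟺ (1) ∧ (2)" with no finiteness assumption, but
the implication "u.s.c. ⟹ (2)" FAILS without one: on `X = Spec ℤ` (Noetherian, sober) the map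
`H(generic point) = 0`, `H((p_n)) = -n` (`p_n` the `n`-th prime) into `ℤ` has all `X_{≥ν}`
closed (finite sets of closed points, or `X`), yet no non-empty open set on which `H = 0`. The
printed argument ("`U = X_μ ∩ cl{y} = ⋃_{ν>μ} (X − X_{≥ν}) ∩ cl{y}`") silently uses that only
finitely many `ν` occur, i.e. part (c). We therefore prove "⇒ (2)" under the finiteness of the
set of values (which holds in the book's application by (c), or by Thm. 2.15), and "⇐" and (c)
exactly as printed. Maximality in (b) is taken among the VALUES of `H` (as in the application,
Def. 2.35: `Σ_X^max` = maximal elements of `Σ_X = H_X(X)`).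

## Sources

* V. Cossart, U. Jannsen, S. Saito, *Desingularization: Invariants and Strategy — Application
  to Dimension 2*, LNM 2270 (2020), Lemma 2.34 and its proof (Ch. 2, after Thm. 2.33).
  [CossartJannsenSaito2020]
-/

open TopologicalSpace Set

open _root_.Topology

namespace Literature.Topology.NoetherianSpaces

variable {X : Type*} [TopologicalSpace X] {G : Type*} [PartialOrder G]

/-! ## Noetherian induction over irreducible closed subsets -/

/-- **Noetherian induction through irreducible closed subsets.** Let `P` be a property of
subsets of a Noetherian space which passes to finite unions of closed subsets. If `P Z` holds
for every irreducible closed `Z` as soon as it holds for all proper closed subsets of `Z`, then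
`P` holds for every closed subset (well-founded induction on closed subsets plus the
decomposition into irreducible components). [folklore] -/
theorem NoetherianSpace.closeds_irreducible_induction [NoetherianSpace X] (P : Set X → Prop)
    (hunion : ∀ S : Set (Set X), S.Finite → (∀ t ∈ S, IsClosed t) → (∀ t ∈ S, P t) → P (⋃₀ S))
    (hirr : ∀ Z : Set X, IsClosed Z → IsIrreducible Z →
      (∀ Z' : Set X, IsClosed Z' → Z' ⊂ Z → P Z') → P Z)
    {Z : Set X} (hZ : IsClosed Z) : P Z := by
  suffices h : ∀ C : Closeds X, P C from h ⟨Z, hZ⟩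
  intro C
  induction C using WellFoundedLT.induction with
  | ind C ih =>
    -- `Z' ⊂ C` for a closed `Z'` is `⟨Z', _⟩ < C` in `Closeds X`
    have hlt : ∀ {Z' : Set X} (hZ' : IsClosed Z'), Z' ⊂ (C : Set X) →
        (⟨Z', hZ'⟩ : Closeds X) < C := fun _ h => h
    obtain ⟨S, hSf, hSc, hSi, hC⟩ : ∃ S : Set (Set X), S.Finite ∧ (∀ t ∈ S, IsClosed t) ∧
        (∀ t ∈ S, IsIrreducible t) ∧ (C : Set X) = ⋃₀ S :=
      NoetherianSpace.exists_finite_set_isClosed_irreducible C.isClosed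
    have hP : ∀ t ∈ S, P t := by
      intro t ht
      have htC : t ⊆ (C : Set X) := by
        rw [hC]
        exact subset_sUnion_of_mem ht
      by_cases heq : t = (C : Set X)
      · rw [heq]
        exact hirr _ C.isClosed (heq ▸ hSi t ht) fun Z' hZ' h => ih ⟨Z', hZ'⟩ (hlt hZ' h)
      · exact ih ⟨t, hSc t ht⟩ (hlt (hSc t ht) (ssubset_iff_subset_ne.mpr ⟨htC, heq⟩))
    rw [hC]
    exact hunion S hSf hSc hP

/-! ## Upper semi-continuity implies (1) -/

/-- **u.s.c. ⟹ (1)**: if `X_{≥H(y)}` is closed then `H` does not decrease under specialisation,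
`y ⤳ x ⟹ H(y) ≤ H(x)`. [cite: CossartJannsenSaito2020, Lemma 2.34 (a)] -/
theorem le_of_specializes_of_isClosed_setOf_le (H : X → G) (husc : ∀ ν, IsClosed {x | ν ≤ H x})
    {x y : X} (h : y ⤳ x) : H y ≤ H x :=
  (h.mem_closed (husc (H y))) le_rfl

/-! ## (a) "⇐": conditions (1) and (2) imply upper semi-continuity -/

/-- **CJS Lemma 2.34 (a), "⇐".** On a Noetherian quasi-sober space, if (1) `H` does not decrease
under specialisation and (2) every point `y` has an open neighbourhood on whose trace on
`cl{y}` the value is `H(y)`, then `H` is upper semi-continuous: every `X_{≥ν}` is closed.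
Proof as printed, by Noetherian induction: for an irreducible closed `Y` with generic point `η`
and `μ = H(η)`, either `ν ≤ μ` and `Y_{≥ν} = Y`, or `Y_{≥ν}` lies in the proper closed subset
`Y ∖ U`. [cite: CossartJannsenSaito2020, Lemma 2.34 (a)] -/
theorem isClosed_setOf_le_of_specializes [NoetherianSpace X] [QuasiSober X] (H : X → G)
    (h1 : ∀ x y : X, y ⤳ x → H y ≤ H x)
    (h2 : ∀ y : X, ∃ U : Set X, IsOpen U ∧ y ∈ U ∧ ∀ x ∈ U, x ∈ closure {y} → H x = H y)
    (ν : G) : IsClosed {x | ν ≤ H x} := by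
  set A : Set X := {x | ν ≤ H x}
  suffices h : IsClosed (univ ∩ A) by rwa [univ_inter] at h
  refine NoetherianSpace.closeds_irreducible_induction (fun Z => IsClosed (Z ∩ A)) ?_ ?_
    isClosed_univ
  · intro S hSf hSc hP
    rw [sUnion_eq_biUnion, iUnion₂_inter]
    exact hSf.isClosed_biUnion fun t ht => hP t ht
  · intro Z hZ hZi ih
    set η := hZi.genericPoint
    have hgen : IsGenericPoint η Z := hZi.isGenericPoint_genericPoint hZ
    obtain ⟨U, hU, hηU, hUeq⟩ := h2 η
    by_cases hν : ν ≤ H η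
    · -- `Z ∩ A = Z`
      have : Z ∩ A = Z := by
        refine inter_eq_left.mpr fun x hx => ?_
        exact hν.trans (h1 x η (hgen.specializes hx))
      rw [this]
      exact hZ
    · -- `Z ∩ A ⊆ Z ∖ U`, a proper closed subset
      have hsub : Z ∩ A = (Z ∩ Uᶜ) ∩ A := by
        ext x
        simp only [mem_inter_iff, mem_compl_iff]
        constructor
        · rintro ⟨hxZ, hxA⟩
          refine ⟨⟨hxZ, fun hxU => hν ?_⟩, hxA⟩
          have := hUeq x hxU (by rw [hgen.def]; exact hxZ)
          rw [← this]
          exact hxA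
        · rintro ⟨⟨hxZ, -⟩, hxA⟩
          exact ⟨hxZ, hxA⟩
      rw [hsub]
      refine ih _ (hZ.inter hU.isClosed_compl) ?_
      refine ssubset_iff_subset_ne.mpr ⟨inter_subset_left, fun heq => ?_⟩
      have : η ∈ Z ∩ Uᶜ := heq.symm ▸ hgen.mem
      exact this.2 hηU

/-! ## (c): condition (2) forces finitely many values -/

omit [PartialOrder G] in
/-- **CJS Lemma 2.34 (c).** On a Noetherian quasi-sober space, a map satisfying condition (2)
takes only finitely many values. Proof as printed, by Noetherian induction: on an irreducible
closed `Y` with generic point `η`, the values on `Y` are `H(η)` and the values on the proper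
closed subset `Y ∖ U`. [cite: CossartJannsenSaito2020, Lemma 2.34 (c)] -/
theorem finite_range_of_eqOn_nhds_generic [NoetherianSpace X] [QuasiSober X] (H : X → G)
    (h2 : ∀ y : X, ∃ U : Set X, IsOpen U ∧ y ∈ U ∧ ∀ x ∈ U, x ∈ closure {y} → H x = H y) :
    (range H).Finite := by
  suffices h : (H '' univ).Finite by rwa [image_univ] at h
  refine NoetherianSpace.closeds_irreducible_induction (fun Z => (H '' Z).Finite) ?_ ?_
    isClosed_univ
  · intro S hSf _ hP
    rw [sUnion_eq_biUnion, image_iUnion₂]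
    exact hSf.biUnion fun t ht => hP t ht
  · intro Z hZ hZi ih
    set η := hZi.genericPoint
    have hgen : IsGenericPoint η Z := hZi.isGenericPoint_genericPoint hZ
    obtain ⟨U, hU, hηU, hUeq⟩ := h2 η
    have hA : (H '' (Z ∩ Uᶜ)).Finite := by
      refine ih _ (hZ.inter hU.isClosed_compl) ?_
      refine ssubset_iff_subset_ne.mpr ⟨inter_subset_left, fun heq => ?_⟩
      have : η ∈ Z ∩ Uᶜ := heq.symm ▸ hgen.mem
      exact this.2 hηU
    refine (hA.insert (H η)).subset ?_
    rintro _ ⟨x, hxZ, rfl⟩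
    by_cases hxU : x ∈ U
    · exact Or.inl (hUeq x hxU (by rw [hgen.def]; exact hxZ))
    · exact Or.inr ⟨x, ⟨hxZ, hxU⟩, rfl⟩

/-- **CJS Lemma 2.34 (a) "⇐" and (c) combined**: under (1) and (2) on a Noetherian quasi-sober
space, `H` is upper semi-continuous with finitely many values.
[cite: CossartJannsenSaito2020, Lemma 2.34] -/
theorem isClosed_setOf_le_and_finite_range [NoetherianSpace X] [QuasiSober X] (H : X → G)
    (h1 : ∀ x y : X, y ⤳ x → H y ≤ H x)
    (h2 : ∀ y : X, ∃ U : Set X, IsOpen U ∧ y ∈ U ∧ ∀ x ∈ U, x ∈ closure {y} → H x = H y) :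
    (∀ ν, IsClosed {x | ν ≤ H x}) ∧ (range H).Finite :=
  ⟨isClosed_setOf_le_of_specializes H h1 h2, finite_range_of_eqOn_nhds_generic H h2⟩

/-! ## (a) "⇒ (2)" and (b), for upper semi-continuous maps with finitely many values -/

section FiniteValues

variable (H : X → G) (husc : ∀ ν, IsClosed {x | ν ≤ H x}) (hfin : (range H).Finite)

omit [TopologicalSpace X] in
/-- The stratum `X_ν = {H = ν}` is `X_{≥ν}` minus the finitely many closed `X_{≥μ}`, `μ > ν` a
value. [cite: CossartJannsenSaito2020, Lemma 2.34 (b) (proof)] -/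
theorem fiber_eq_setOf_le_diff (ν : G) :
    {x | H x = ν} = {x | ν ≤ H x} \ ⋃ μ ∈ {μ ∈ range H | ν < μ}, {x | μ ≤ H x} := by
  ext x
  simp only [mem_setOf_eq, mem_sdiff, mem_iUnion, mem_range, exists_prop, not_exists, not_and]
  constructor
  · rintro rfl
    exact ⟨le_rfl, fun μ ⟨_, hlt⟩ hle => absurd (lt_of_lt_of_le hlt hle) (lt_irrefl _)⟩
  · rintro ⟨hle, hno⟩
    by_contra hne
    exact hno (H x) ⟨⟨x, rfl⟩, lt_of_le_of_ne hle (Ne.symm hne)⟩ le_rfl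

include husc hfin in
/-- **CJS Lemma 2.34 (b)**: for an upper semi-continuous map with finitely many values every
stratum `X_ν = {x | H(x) = ν}` is locally closed. [cite: CossartJannsenSaito2020, Lemma 2.34 (b)] -/
theorem isLocallyClosed_fiber (ν : G) : IsLocallyClosed {x | H x = ν} := by
  rw [fiber_eq_setOf_le_diff H ν, sdiff_eq]
  refine (husc ν).isLocallyClosed.inter (IsOpen.isLocallyClosed ?_)
  rw [isOpen_compl_iff]
  exact (hfin.subset (sep_subset _ _)).isClosed_biUnion fun μ _ => husc μ

include husc in
/-- **CJS Lemma 2.34 (b)**: the closure of a stratum `X_ν` lies in `X_{≥ν}`.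
[cite: CossartJannsenSaito2020, Lemma 2.34 (b)] -/
theorem closure_fiber_subset (ν : G) : closure {x | H x = ν} ⊆ {x | ν ≤ H x} :=
  closure_minimal (fun _ hx => le_of_eq (Eq.symm hx)) (husc ν)

include husc in
/-- **CJS Lemma 2.34 (b)**: a stratum `X_ν` with `ν` maximal among the values of `H` is closed
(it equals `X_{≥ν}`). [cite: CossartJannsenSaito2020, Lemma 2.34 (b)] -/
theorem isClosed_fiber_of_maximal {ν : G} (hν : Maximal (· ∈ range H) ν) :
    IsClosed {x | H x = ν} := by
  have : {x | H x = ν} = {x | ν ≤ H x} := by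
    ext x
    simp only [mem_setOf_eq]
    exact ⟨fun h => h ▸ le_rfl, fun h => le_antisymm (hν.2 ⟨x, rfl⟩ h) h⟩
  rw [this]
  exact husc ν

include husc hfin in
/-- **CJS Lemma 2.34 (b)**: for an upper semi-continuous map with finitely many values the locus
`X_max = {x | H(x) is maximal among the values}` is closed (a finite union of closed maximal
strata). [cite: CossartJannsenSaito2020, Lemma 2.34 (b)] -/
theorem isClosed_setOf_maximal : IsClosed {x | Maximal (· ∈ range H) (H x)} := by
  have : {x | Maximal (· ∈ range H) (H x)} =
      ⋃ ν ∈ {ν ∈ range H | Maximal (· ∈ range H) ν}, {x | H x = ν} := by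
    ext x
    simp only [mem_setOf_eq, mem_iUnion, exists_prop]
    exact ⟨fun h => ⟨H x, ⟨⟨x, rfl⟩, h⟩, rfl⟩, fun ⟨ν, ⟨_, hν⟩, hx⟩ => hx ▸ hν⟩
  rw [this]
  exact (hfin.subset (sep_subset _ _)).isClosed_biUnion
    fun ν hν => isClosed_fiber_of_maximal H husc hν.2

include husc hfin in
/-- **CJS Lemma 2.34 (a), "⇒ (2)", for finitely many values**: if `H` is upper semi-continuous
and takes finitely many values, every `y` has an open neighbourhood `U` with `H = H(y)` on
`U ∩ cl{y}` — namely the complement of the finitely many closed `X_{≥ν}`, `ν` a value not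
`≤ H(y)`. (Without the finiteness this fails, see the module docstring.)
[cite: CossartJannsenSaito2020, Lemma 2.34 (a)] -/
theorem exists_open_eqOn_closure_of_finite (y : X) :
    ∃ U : Set X, IsOpen U ∧ y ∈ U ∧ ∀ x ∈ U, x ∈ closure {y} → H x = H y := by
  refine ⟨(⋃ ν ∈ {ν ∈ range H | ¬ν ≤ H y}, {x | ν ≤ H x})ᶜ, ?_, ?_, ?_⟩
  · rw [isOpen_compl_iff]
    exact (hfin.subset (sep_subset _ _)).isClosed_biUnion fun ν _ => husc ν
  · simp only [mem_compl_iff, mem_iUnion, mem_setOf_eq, exists_prop, not_exists, not_and]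
    exact fun ν ⟨_, hν⟩ hle => hν hle
  · intro x hxU hxy
    have hyx : H y ≤ H x :=
      le_of_specializes_of_isClosed_setOf_le H husc (specializes_iff_mem_closure.mpr hxy)
    by_contra hne
    apply hxU
    simp only [mem_iUnion, mem_setOf_eq, exists_prop]
    exact ⟨H x, ⟨⟨x, rfl⟩, fun hle => hne (le_antisymm hle hyx)⟩, le_rfl⟩

end FiniteValues

/-- **CJS Lemma 2.34 (a), corrected equivalence**: on a Noetherian quasi-sober space, `H` is
upper semi-continuous with finitely many values iff (1) and (2) hold.
[cite: CossartJannsenSaito2020, Lemma 2.34 (a), (c)] -/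
theorem isClosed_setOf_le_and_finite_iff [NoetherianSpace X] [QuasiSober X] (H : X → G) :
    ((∀ ν, IsClosed {x | ν ≤ H x}) ∧ (range H).Finite) ↔
      (∀ x y : X, y ⤳ x → H y ≤ H x) ∧
        ∀ y : X, ∃ U : Set X, IsOpen U ∧ y ∈ U ∧ ∀ x ∈ U, x ∈ closure {y} → H x = H y :=
  ⟨fun ⟨husc, hfin⟩ => ⟨fun _ _ h => le_of_specializes_of_isClosed_setOf_le H husc h,
    exists_open_eqOn_closure_of_finite H husc hfin⟩,
   fun ⟨h1, h2⟩ => isClosed_setOf_le_and_finite_range H h1 h2⟩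

end Literature.Topology.NoetherianSpaces
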